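import Summits.MatrixMultiplication.MatrixMultiplication.Theorems.AbelianSTPPCensusShapeCertDefs

/-!
# Abelian STPP census — kernel evaluation of the `ShapeCert` checker (E: orders 100, 101, 102, 103, 104, 105, 106, 107, 108, 109, 110, 111)

`check M = true` by `decide +kernel` (no `native_decide`), one theorem per order (per range of small orders),
so that every kernel run starts with empty caches and stays under the default heartbeat budget
(≈ 2–6 s per order below 100, up to ≈ 30 s at the orders 125 and 127).
Consumed by `…ShapeCertFinal` (`check_le_127`).
-/

set_option linter.dupNamespace false -- `MatrixMultiplication.MatrixMultiplication` (summit = problem, D-0017)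
set_option autoImplicit false

namespace Summit.MatrixMultiplication.MatrixMultiplication.Theorems.ShapeCert

/-- certificate check at order `100` (kernel evaluation) -/
theorem check_100 : check 100 = true := by decide +kernel

/-- certificate check at order `101` (kernel evaluation) -/
theorem check_101 : check 101 = true := by decide +kernel

/-- certificate check at order `102` (kernel evaluation) -/
theorem check_102 : check 102 = true := by decide +kernel

/-- certificate check at order `103` (kernel evaluation) -/
theorem check_103 : check 103 = true := by decide +kernel

/-- certificate check at order `104` (kernel evaluation) -/
theorem check_104 : check 104 = true := by decide +kernel

/-- certificate check at order `105` (kernel evaluation) -/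
theorem check_105 : check 105 = true := by decide +kernel

/-- certificate check at order `106` (kernel evaluation) -/
theorem check_106 : check 106 = true := by decide +kernel

/-- certificate check at order `107` (kernel evaluation) -/
theorem check_107 : check 107 = true := by decide +kernel

/-- certificate check at order `108` (kernel evaluation) -/
theorem check_108 : check 108 = true := by decide +kernel

/-- certificate check at order `109` (kernel evaluation) -/
theorem check_109 : check 109 = true := by decide +kernel

/-- certificate check at order `110` (kernel evaluation) -/
theorem check_110 : check 110 = true := by decide +kernel

/-- certificate check at order `111` (kernel evaluation) -/
theorem check_111 : check 111 = true := by decide +kernel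

end Summit.MatrixMultiplication.MatrixMultiplication.Theorems.ShapeCert
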